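import Mathlib
import Literature.Computability.Complexity.Classes
import Literature.Computability.Complexity.BoolEncodings
import Literature.Computability.Complexity.CNF
import Literature.Computability.Complexity.BinarySubtraction
import Literature.Computability.Complexity.TautCertificates
import Literature.Computability.MetaComplexity.ProofSystems
import Literature.Computability.MetaComplexity.Frege
import Summits.PneNP.PneNP.Theorems.LatticeMagicTargetDefs

/-!
# `stub_bridge`, part 1/6: tagged variables, stretched assignments, bit vectors, block conjunctions

Line `SketchIdeator5` of crux `Target` (stmt-PneNP-10709), stub `stub_bridge`: Krajíček's route from
the hard bit-vector game for `(g, B)` to Hypothesis (ST) (arXiv:2506.20221 §2) — some Cook–Reckhow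
proof system `V` for `TAUT` whose search problem `DD_V` is hard for `FP` students with `O(1)`
rounds. The chain `LatticeMagicTargetStubBridge{Forms,Instance,Code,Verifier,Student}.lean`,
`LatticeMagicTargetStubBridge.lean` proves it; this first file is pure bookkeeping on strings and
formulas:

* `tagVar v y` — the variable `y` relabelled into the block tagged by the bit vector `v` (binary
  numeral `v ++ bin (y + 1)`): numeral, value, joint injectivity for tags of one length;
* `stretch t s` — every bit of `s` repeated `2^t` times, the assignment transport matching `tagVar`
  (`getD_stretch_tagVar`), and its description as `t`-fold doubling (`dbl_iterate`);
* `allVecs t` — the `2^t` bit vectors of length `t` (membership, no duplicates) and the capped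
  doubling fold `vecsFold` computing them (capped so that it stays polynomial on every input);
* `conjAcc blk ws v φ` — the left-nested conjunction of blocks `blk w_j v_j` accumulated on `φ`
  (semantics, tautology, falsification, variables).

## References

* J. Krajíček, *A proof complexity conjecture and the Incompleteness theorem*, arXiv:2506.20221, §2
  (`DD_P`, Hypothesis (ST)); J. Krajíček, LMCS 16 (3:9) 2020.
* S. Arora, B. Barak, *Computational Complexity: A Modern Approach*, CUP 2009, §0.1 (codes), §1.3
  (closure of polynomial time), §2.3 (CNFs, Cook–Levin), Example 2.21.
* S. A. Cook, R. A. Reckhow, JSL 44 (1979), §1 (proof systems).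
-/

set_option linter.dupNamespace false -- summit = sub-problem (D-0017)

namespace Summit.PneNP.PneNP.Theorems.LatticeMagicTarget

open Literature.Computability.Complexity
open Literature.Computability.MetaComplexity
open _root_.Computability

namespace StubBridge

/-! ### Tagged variables -/

/-- The variable `y` of the block tagged by the bit vector `v`: the number whose binary numeral
(least significant bit first) is `v ++ bin (y + 1)`. -/
def tagVar (v : List Bool) (y : ℕ) : ℕ :=
  bitsToNat (v ++ encodeNat (y + 1))

/-- `bin (y + 1)` is nonempty. -/
theorem encodeNat_succ_ne_nil (y : ℕ) : encodeNat (y + 1) ≠ [] := by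
  intro h
  have := bitsToNat_encodeNat (y + 1)
  rw [h, bitsToNat_nil] at this
  exact absurd this (by omega)

/-- `bin (y + 1)` ends in `true`. -/
theorem getLast?_encodeNat_succ (y : ℕ) : (encodeNat (y + 1)).getLast? = some true := by
  rcases isCanonicalNum_encodeNat (y + 1) with h | h
  · exact absurd h (encodeNat_succ_ne_nil y)
  · exact h

/-- The numeral of a tagged variable is the tag followed by `bin (y + 1)`. -/
theorem encodeNat_tagVar (v : List Bool) (y : ℕ) :
    encodeNat (tagVar v y) = v ++ encodeNat (y + 1) := by
  unfold tagVar
  apply encodeNat_bitsToNat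
  right
  rw [List.getLast?_append, getLast?_encodeNat_succ]
  rfl

/-- The value of a tagged variable. -/
theorem tagVar_eq (v : List Bool) (y : ℕ) : tagVar v y = bitsToNat v + 2 ^ v.length * (y + 1) := by
  unfold tagVar
  rw [bitsToNat_append, bitsToNat_encodeNat]

/-- Tagging is injective on tags of a fixed length, jointly in the tag and the variable. -/
theorem tagVar_inj {v v' : List Bool} {y y' : ℕ} (hlen : v.length = v'.length)
    (h : tagVar v y = tagVar v' y') : v = v' ∧ y = y' := by
  have hs : v ++ encodeNat (y + 1) = v' ++ encodeNat (y' + 1) := by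
    rw [← encodeNat_tagVar, ← encodeNat_tagVar, h]
  have h1 : v = v' := by
    have := congrArg (List.take v.length) hs
    rwa [List.take_left, hlen, List.take_left] at this
  subst h1
  refine ⟨rfl, ?_⟩
  have h2 : encodeNat (y + 1) = encodeNat (y' + 1) := List.append_cancel_left hs
  have := congrArg bitsToNat h2
  rw [bitsToNat_encodeNat, bitsToNat_encodeNat] at this
  omega

/-- For a fixed tag, `tagVar v` is injective. -/
theorem tagVar_injective (v : List Bool) : Function.Injective (tagVar v) :=
  fun _ _ h => (tagVar_inj rfl h).2

/-! ### Stretching an assignment -/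

/-- Every bit of `s` repeated `2^t` times. -/
def stretch (t : ℕ) (s : List Bool) : List Bool :=
  s.flatMap fun b => List.replicate (2 ^ t) b

/-- `stretch 0` is the identity. -/
@[simp] theorem stretch_zero (s : List Bool) : stretch 0 s = s := by
  induction s with
  | nil => rfl
  | cons b s ih => simp [stretch] at ih ⊢

/-- Reading a stretched string: position `2^t * q + i` (`i < 2^t`) holds bit `q` of `s`. -/
theorem getD_stretch (t : ℕ) (s : List Bool) (q i : ℕ) (hi : i < 2 ^ t) :
    (stretch t s).getD (2 ^ t * q + i) false = s.getD q false := by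
  induction s generalizing q with
  | nil => simp [stretch]
  | cons b s ih =>
    have hst : stretch t (b :: s) = List.replicate (2 ^ t) b ++ stretch t s := by
      simp [stretch]
    rw [hst]
    cases q with
    | zero =>
      rw [Nat.mul_zero, Nat.zero_add, List.getD_eq_getElem?_getD, List.getElem?_append_left (by simpa using hi)]
      simp [hi]
    | succ q =>
      rw [List.getD_eq_getElem?_getD, List.getElem?_append_right (by simp; rw [Nat.mul_succ]; omega)]
      have := ih q
      rw [List.getD_eq_getElem?_getD] at this
      simp only [List.length_replicate]
      rw [show 2 ^ t * (q + 1) + i - 2 ^ t = 2 ^ t * q + i by rw [Nat.mul_succ]; omega, this]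
      simp

/-- **The transport identity**: under the assignment `stretch t (false :: s)` the tagged variable
`tagVar v y` (`|v| = t`) reads bit `y` of `s`. -/
theorem getD_stretch_tagVar {t : ℕ} {v : List Bool} (hv : v.length = t) (s : List Bool) (y : ℕ) :
    (stretch t (false :: s)).getD (tagVar v y) false = s.getD y false := by
  rw [tagVar_eq, hv, add_comm, getD_stretch t (false :: s) (y + 1) (bitsToNat v) (hv ▸ bitsToNat_lt v)]
  simp

/-- Doubling every bit. -/
def dbl (s : List Bool) : List Bool := s.flatMap fun b => [b, b]

/-- One more doubling stretches once more. -/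
theorem dbl_stretch (t : ℕ) (s : List Bool) : dbl (stretch t s) = stretch (t + 1) s := by
  induction s with
  | nil => rfl
  | cons b s ih =>
    have h1 : stretch t (b :: s) = List.replicate (2 ^ t) b ++ stretch t s := by simp [stretch]
    have h2 : stretch (t + 1) (b :: s) = List.replicate (2 ^ (t + 1)) b ++ stretch (t + 1) s := by
      simp [stretch]
    have h3 : ∀ n, dbl (List.replicate n b) = List.replicate (2 * n) b := by
      intro n
      induction n with
      | zero => rfl
      | succ n ihn =>
        rw [List.replicate_succ, show dbl (b :: List.replicate n b) = b :: b :: dbl (List.replicate n b)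
          by simp [dbl], ihn]
        rw [show 2 * (n + 1) = (2 * n + 1) + 1 by ring, List.replicate_succ, List.replicate_succ]
    rw [h1, h2, show dbl (List.replicate (2 ^ t) b ++ stretch t s) =
      dbl (List.replicate (2 ^ t) b) ++ dbl (stretch t s) by simp [dbl], ih, h3, pow_succ, mul_comm]

/-- `stretch t` is `t`-fold doubling. -/
theorem dbl_iterate (t : ℕ) (s : List Bool) : dbl^[t] s = stretch t s := by
  induction t with
  | zero => simp
  | succ t ih => rw [Function.iterate_succ_apply', ih, dbl_stretch]

/-! ### All bit vectors of a length -/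

/-- The `2^t` bit vectors of length `t`. -/
def allVecs : ℕ → List (List Bool)
  | 0 => [[]]
  | t + 1 => (allVecs t).map (List.cons false) ++ (allVecs t).map (List.cons true)

/-- There are `2^t` of them. -/
theorem length_allVecs (t : ℕ) : (allVecs t).length = 2 ^ t := by
  induction t with
  | zero => rfl
  | succ t ih => simp [allVecs, ih, pow_succ, mul_two]

/-- Membership: exactly the vectors of length `t`. -/
theorem mem_allVecs_iff {t : ℕ} {v : List Bool} : v ∈ allVecs t ↔ v.length = t := by
  induction t generalizing v with
  | zero => cases v <;> simp [allVecs]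
  | succ t ih =>
    cases v with
    | nil => simp [allVecs]
    | cons b v =>
      cases b <;> simp [allVecs, ih]

/-- No duplicates. -/
theorem nodup_allVecs (t : ℕ) : (allVecs t).Nodup := by
  induction t with
  | zero => simp [allVecs]
  | succ t ih =>
    simp only [allVecs]
    refine List.Nodup.append ?_ ?_ ?_
    · exact ih.map fun _ _ h => List.tail_eq_of_cons_eq h
    · exact ih.map fun _ _ h => List.tail_eq_of_cons_eq h
    · intro x hx hx'
      obtain ⟨a, -, rfl⟩ := List.mem_map.1 hx
      obtain ⟨b, -, hb⟩ := List.mem_map.1 hx'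
      cases hb

/-- The step of the capped doubling fold: double the list (prepending both bits) while it has at
most `m` elements (the cap keeps the fold polynomial on every input). -/
def vecsStep (m : ℕ) (acc : List (List Bool)) : List (List Bool) :=
  if acc.length ≤ m then acc.map (List.cons false) ++ acc.map (List.cons true) else acc

/-- The capped doubling fold over a list of `t` items (the items only clock the fold). -/
def vecsFold (m : ℕ) (ws : List (List Bool)) : List (List Bool) :=
  ws.foldl (fun acc _ => vecsStep m acc) [[]]

/-- Below the cap the fold enumerates all bit vectors: `2^t ≤ m + 1` gives `allVecs t`. -/
theorem vecsFold_eq_allVecs {m : ℕ} {ws : List (List Bool)} (h : 2 ^ ws.length ≤ m + 1) :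
    vecsFold m ws = allVecs ws.length := by
  suffices key : ∀ (l : List (List Bool)) (j : ℕ), 2 ^ (j + l.length) ≤ m + 1 →
      l.foldl (fun acc _ => vecsStep m acc) (allVecs j) = allVecs (j + l.length) by
    simpa [vecsFold, allVecs] using key ws 0 (by simpa using h)
  intro l
  induction l with
  | nil => intro j _; simp
  | cons w l ih =>
    intro j hj
    rw [List.foldl_cons]
    have hj' : 2 ^ (j + 1 + l.length) ≤ m + 1 := by
      rw [show j + 1 + l.length = j + (w :: l).length by simp; omega]; exact hj
    have hstep : vecsStep m (allVecs j) = allVecs (j + 1) := by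
      unfold vecsStep
      rw [if_pos]
      · rfl
      · rw [length_allVecs]
        have : 2 ^ (j + 1) ≤ m + 1 :=
          le_trans (Nat.pow_le_pow_right (by norm_num) (by omega)) hj'
        rw [pow_succ] at this
        omega
    rw [hstep, ih (j + 1) hj']
    simp only [List.length_cons]
    congr 1
    omega

/-- The capped fold never holds more than `2m + 1` vectors. -/
theorem length_foldl_vecsStep_le (m : ℕ) (l acc : List (List Bool)) (hacc : acc.length ≤ 2 * m + 1) :
    (l.foldl (fun acc _ => vecsStep m acc) acc).length ≤ 2 * m + 1 := by
  induction l generalizing acc with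
  | nil => simpa using hacc
  | cons w l ih =>
    rw [List.foldl_cons]
    apply ih
    unfold vecsStep
    split_ifs with h
    · simp; omega
    · exact hacc

/-- Every vector held by the capped fold is at most as long as the number of items read. -/
theorem length_le_of_mem_foldl_vecsStep (m : ℕ) (l acc : List (List Bool)) (n : ℕ)
    (hacc : ∀ v ∈ acc, v.length ≤ n) :
    ∀ v ∈ l.foldl (fun acc _ => vecsStep m acc) acc, v.length ≤ n + l.length := by
  induction l generalizing acc n with
  | nil => simpa using hacc
  | cons w l ih =>
    rw [List.foldl_cons]
    intro v hv
    have := ih (vecsStep m acc) (n + 1) (fun v hv => by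
      unfold vecsStep at hv
      split_ifs at hv
      · simp only [List.mem_append, List.mem_map] at hv
        rcases hv with ⟨a, ha, rfl⟩ | ⟨a, ha, rfl⟩ <;> simp [hacc a ha]
      · exact (hacc v hv).trans (Nat.le_succ n)) v hv
    simpa [add_assoc, add_comm 1] using this

/-! ### Block conjunctions -/

variable (blk : List Bool → Bool → PropForm ℕ)

/-- The left-nested conjunction `(⋯((φ ∧ blk w₀ v₀) ∧ blk w₁ v₁)⋯) ∧ blk w_{t-1} v_{t-1}` of the
blocks of the items `ws` against the bits of `v` (missing bits read `false`), accumulated on `φ` —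
written as the recursion the code generator's fold performs. -/
def conjAcc : List (List Bool) → List Bool → PropForm ℕ → PropForm ℕ
  | [], _, φ => φ
  | w :: ws, v, φ => conjAcc ws (v.drop 1) (PropForm.conj φ (blk w (v.headD false)))

variable {blk}

/-- `headD` is bit `0`. -/
theorem headD_eq_getD (v : List Bool) : v.headD false = v.getD 0 false := by
  cases v <;> rfl

/-- Bits of the tail. -/
theorem getD_drop_one (v : List Bool) (j : ℕ) : (v.drop 1).getD j false = v.getD (j + 1) false := by
  cases v <;> simp

/-- **Semantics of the block conjunction.** -/
theorem eval_conjAcc_iff (σ : ℕ → Bool) :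
    ∀ (ws : List (List Bool)) (v : List Bool) (φ : PropForm ℕ),
      (conjAcc blk ws v φ).eval σ = true ↔
        φ.eval σ = true ∧ ∀ (j : ℕ) (w : List Bool), ws[j]? = some w → (blk w (v.getD j false)).eval σ = true
  | [], v, φ => by simp [conjAcc]
  | w :: ws, v, φ => by
    rw [conjAcc, eval_conjAcc_iff σ ws]
    simp only [PropForm.eval, Bool.and_eq_true, headD_eq_getD, getD_drop_one]
    constructor
    · rintro ⟨⟨h1, h2⟩, h3⟩
      refine ⟨h1, fun j w' hw' => ?_⟩
      cases j with
      | zero =>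
        simp only [List.getElem?_cons_zero, Option.some.injEq] at hw'
        subst hw'
        exact h2
      | succ j =>
        rw [List.getElem?_cons_succ] at hw'
        exact h3 j w' hw'
    · rintro ⟨h1, h3⟩
      exact ⟨⟨h1, h3 0 w rfl⟩, fun j w' hw' => h3 (j + 1) w' (by rw [List.getElem?_cons_succ]; exact hw')⟩

/-- A block conjunction of tautologies is a tautology. -/
theorem isTautology_conjAcc {ws : List (List Bool)} {v : List Bool} {φ : PropForm ℕ}
    (hφ : φ.IsTautology)
    (h : ∀ (j : ℕ) (w : List Bool), ws[j]? = some w → (blk w (v.getD j false)).IsTautology) :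
    (conjAcc blk ws v φ).IsTautology :=
  fun σ => (eval_conjAcc_iff σ ws v φ).2 ⟨hφ σ, fun j w hw => h j w hw σ⟩

/-- Every block of a tautological block conjunction is a tautology. -/
theorem isTautology_of_conjAcc {ws : List (List Bool)} {v : List Bool} {φ : PropForm ℕ}
    (h : (conjAcc blk ws v φ).IsTautology) {j : ℕ} {w : List Bool} (hw : ws[j]? = some w) :
    (blk w (v.getD j false)).IsTautology :=
  fun σ => ((eval_conjAcc_iff σ ws v φ).1 (h σ)).2 j w hw

/-- A false block falsifies the block conjunction. -/
theorem eval_conjAcc_eq_false {ws : List (List Bool)} {v : List Bool} {φ : PropForm ℕ} {σ : ℕ → Bool}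
    {j : ℕ} {w : List Bool} (hw : ws[j]? = some w) (h : (blk w (v.getD j false)).eval σ = false) :
    (conjAcc blk ws v φ).eval σ = false := by
  by_contra hne
  have ht : (conjAcc blk ws v φ).eval σ = true := by simpa using hne
  have := ((eval_conjAcc_iff σ ws v φ).1 ht).2 j w hw
  rw [h] at this
  exact Bool.false_ne_true this

/-- Variables of a block conjunction come from `φ` or from a block. -/
theorem mem_vars_conjAcc {x : ℕ} :
    ∀ (ws : List (List Bool)) (v : List Bool) (φ : PropForm ℕ), x ∈ (conjAcc blk ws v φ).vars →
      x ∈ φ.vars ∨ ∃ w ∈ ws, ∃ b : Bool, x ∈ (blk w b).vars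
  | [], _, _, h => Or.inl h
  | w :: ws, v, φ, h => by
    rw [conjAcc] at h
    rcases mem_vars_conjAcc ws _ _ h with h | ⟨w', hw', b, hb⟩
    · simp only [PropForm.vars, Finset.mem_union] at h
      rcases h with h | h
      · exact Or.inl h
      · exact Or.inr ⟨w, by simp, _, h⟩
    · exact Or.inr ⟨w', by simp [hw'], b, hb⟩

end StubBridge

/-- **The capped doubling fold enumerates all bit vectors** below the cap (explicit-binder form,
registered sub-goal `stubBridge_vecsFold_eq_allVecs` of stmt-PneNP-10709; chain `stub_bridge` 1/6). -/
theorem stubBridge_vecsFold_eq_allVecs (m : ℕ) (ws : List (List Bool)) (h : 2 ^ ws.length ≤ m + 1) :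
    StubBridge.vecsFold m ws = StubBridge.allVecs ws.length :=
  StubBridge.vecsFold_eq_allVecs h

end Summit.PneNP.PneNP.Theorems.LatticeMagicTarget
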